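import Mathlib
import Summits.Ventures.PercRepro2.Defs
import Summits.Ventures.PercRepro2.Graph
import Summits.Ventures.PercRepro2.OneColourSwitch
import Summits.Ventures.PercRepro2.RegionHubSign
import Summits.Ventures.PercRepro2.SideSwitch
import Summits.Ventures.PercRepro2.TermSwitchDefs
import Summits.Ventures.PercRepro2.M9NoPocketDefs
import Summits.Ventures.PercRepro2.M9PsiOneDefs
import Summits.Ventures.PercRepro2.M9PsiOneWorlds
import Summits.Ventures.PercRepro2.M9PsiOneLink
import Summits.Ventures.PercRepro2.M9PsiOneInj
import Summits.Ventures.PercRepro2.M9PsiTwoDefs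
import Summits.Ventures.PercRepro2.M9PsiTwoWorlds
import Summits.Ventures.PercRepro2.M9PsiTwoNoLink
import Summits.Ventures.PercRepro2.M9PsiTwoLink

/-!
# The unrooted flipped vertices of `Ψ₂ ω` are visible in the image (blind cell PercRepro2,
p3 g34, 2026-08-29; `proofs/P3-REST2.md` §1, claim (iv), first step)

A flipped vertex of `ω` (a joined or `W`-linking `W`-core vertex) is DIRECT if it is `W`-rooted
at `r` or at `s` inside its block (`directW`), else it is rooted only through `d`.  In the image
`ω' = Ψ₂ ω`: the direct flipped vertices lie in `K₂(ω')` (`mem_K2_psiTwo_of_directW`), the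
others do not (`not_mem_K2_psiTwo_of_not_directW`: `{r, s, d} ∪ Kcore ∪ (direct flipped)` is
closed under the open edges of `ω'`), and the non-direct ones are EXACTLY the `Y`-clusters of
`ω' − d` of the `W`-neighbours of `d` outside `K₂(ω')` (`Uset`, `Uset_psiTwo_eq`): an unrooted
flipped vertex reaches `d` by a `W`-path of `ω` through unrooted vertices, which `Ψ₂` turns
into a `Y`-path of `ω' − d` to a `W`-neighbour of `d`.  Own work; std axioms.
-/

namespace Summit.Ventures.PercRepro2

namespace NoPocket

open Finset Classical RegionHub OneColourSwitch SideSwitch TermSwitch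

variable {V : Type*} {E : Type*}

section Defs

variable (ends : E → Sym2 V) (r s d : V) (ω : Config E)

/-- A `W`-core vertex is DIRECT if it is `W`-rooted at `r` or at `s` inside its block. -/
def directW (x : V) : Prop := rootedW ends r s d ω r x ∨ rootedW ends r s d ω s x

/-- The unrooted set of a colouring `ω'`: the `Y`-clusters of `ω' − d` of the `W`-neighbours of
`d` outside `K₂(ω')`. -/
def Uset (ω' : Config E) : Set V :=
  {z | ∃ x e, ends e = s(d, x) ∧ ω' e = false ∧ x ∉ K2 ends r s ω' ∧
    Conn (endsD ends d) ω' x z}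

end Defs

section Unrooted

variable {ends : E → Sym2 V} {p q r s d : V} {ω : Config E}

/-- A vertex `W`-adjacent (in `ω`) to a direct vertex of its block is direct. -/
lemma directW_of_edge {x y : V} {e : E} (hx : directW ends r s d ω x) (hy : y ∈ Mcore ends r s d ω)
    (hends : ends e = s(x, y)) (hω : ω e = false) : directW ends r s d ω y := by
  have hxM : x ∈ Mcore ends r s d ω := by rcases hx with hx | hx <;> exact hx.1
  have hblk := blockIn_eq_of_Mcore_edge hxM hy hends
  have hxy : Conn ends (restrictTo ends (OneColourSwitch.compl ω)
      (blockIn ends (Mcore ends r s d ω) x ∪ {r, s})) x y := by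
    refine conn_of_openAdj ⟨e, ?_, hends⟩
    rw [restrictTo_compl_eq (S := blockIn ends (Mcore ends r s d ω) x ∪ {r, s})
      (Or.inl (mem_blockIn_self _ _)) (Or.inl (hblk ▸ mem_blockIn_self _ _)) hends, hω]
    rfl
  rcases hx with hx | hx
  · left
    refine ⟨hy, ?_⟩
    rw [← hblk]
    exact conn_trans hx.2 hxy
  · right
    refine ⟨hy, ?_⟩
    rw [← hblk]
    exact conn_trans hx.2 hxy

/-- A `W`-core vertex `W`-adjacent (in `ω`) to a terminal is direct. -/
lemma directW_of_term_edge {t y : V} {e : E} (ht : t = r ∨ t = s) (hy : y ∈ Mcore ends r s d ω)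
    (hends : ends e = s(t, y)) (hω : ω e = false) : directW ends r s d ω y := by
  have hc : Conn ends (restrictTo ends (OneColourSwitch.compl ω)
      (blockIn ends (Mcore ends r s d ω) y ∪ {r, s})) t y := by
    refine conn_of_openAdj ⟨e, ?_, hends⟩
    rw [restrictTo_compl_eq (S := blockIn ends (Mcore ends r s d ω) y ∪ {r, s})
      (by rcases ht with rfl | rfl <;> simp) (Or.inl (mem_blockIn_self _ _)) hends, hω]
    rfl
  rcases ht with rfl | rfl
  · exact Or.inl ⟨hy, hc⟩
  · exact Or.inr ⟨hy, hc⟩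

variable (h : IsEX ends p q r s d ω)
include h

/-- **A direct flipped vertex lies in `K₂(Ψ₂ ω)`** (no edge `r–s`). -/
theorem mem_K2_psiTwo_of_directW (hrs : ∀ e, ends e ≠ s(r, s)) {x : V}
    (hx : x ∈ flipSetW ends r s d ω) (hd : directW ends r s d ω x) :
    x ∈ K2 ends r s (psiTwo ends r s d ω) := by
  rcases hd with hd | hd
  · exact mem_K2_iff.2 (Or.inl (conn_psiTwo_of_rootedW h hrs hx hd))
  · exact mem_K2_iff.2 (Or.inr (conn_psiTwo_of_rootedW h hrs hx hd))

/-- **`{r, s, d} ∪ Kcore ∪ (direct flipped vertices)` is closed under the open edges of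
`Ψ₂ ω`.** -/
lemma Zdirect_closed :
    ∀ x ∈ {z | z = r ∨ z = s ∨ z = d ∨ z ∈ Kcore ends r s d ω ∨
      (z ∈ flipSetW ends r s d ω ∧ directW ends r s d ω z)}, ∀ y,
      (openGraph ends (psiTwo ends r s d ω)).Adj x y →
        y ∈ {z | z = r ∨ z = s ∨ z = d ∨ z ∈ Kcore ends r s d ω ∨
          (z ∈ flipSetW ends r s d ω ∧ directW ends r s d ω z)} := by
  intro x hx y hxy
  obtain ⟨hne, e, he, hends⟩ := openGraph_adj.1 hxy
  rcases vertex_cases (ends := ends) (r := r) (s := s) (d := d) (ω := ω) y with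
    hy | hy | hy | hyK | hyM | hyO
  · exact Or.inl hy
  · exact Or.inr (Or.inl hy)
  · exact Or.inr (Or.inr (Or.inl hy))
  · exact Or.inr (Or.inr (Or.inr (Or.inl hyK)))
  · -- `y` in the `W`-core: it is flipped and direct
    refine Or.inr (Or.inr (Or.inr (Or.inr ?_)))
    rcases hx with hx | hx | hx | hxK | ⟨hxF, hxD⟩
    · -- from `r`: the edge is flipped (else closed), so closed in `ω`: `y` direct
      have hyF : y ∈ flipSetW ends r s d ω := by
        by_contra hyF
        rw [psiTwo_term_Mcore h (Or.inl hx) hyM hends, if_neg hyF] at he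
        exact Bool.false_ne_true he
      exact ⟨hyF, directW_of_term_edge (Or.inl hx) hyM hends
        (edge_Mcore_term h hyM (Or.inl hx) (ends_swap (hx ▸ hends)))⟩
    · have hyF : y ∈ flipSetW ends r s d ω := by
        by_contra hyF
        rw [psiTwo_term_Mcore h (Or.inr hx) hyM hends, if_neg hyF] at he
        exact Bool.false_ne_true he
      exact ⟨hyF, directW_of_term_edge (Or.inr hx) hyM hends
        (edge_Mcore_term h hyM (Or.inr hx) (ends_swap (hx ▸ hends)))⟩
    · -- from `d`: an open edge of `Ψ₂ ω` at `d` into the `W`-core is a flipped edge into a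
      -- joined vertex rooted at `oppRoot` (the kept ones are closed)
      have hyJ : y ∈ joinedW ends r s d ω := mem_joinedW_of_nbr hyM (hx ▸ hends)
      refine ⟨Or.inl hyJ, ?_⟩
      by_contra hyD
      have hkept : psiTwo ends r s d ω e = ω e := by
        refine psiTwo_d_joinedW_kept (hx ▸ hends) (fun hr' => hyD ?_)
        unfold oppRoot at hr'
        split_ifs at hr' with hdr
        · exact Or.inr hr'
        · exact Or.inl hr'
      rw [hkept, edge_Mcore_d h hyM (ends_swap (hx ▸ hends))] at he
      exact Bool.false_ne_true he
    · exact (no_edge_core_core h hxK hyM hends).elim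
    · -- from a direct flipped vertex: the edge is inside the flipped set (flipped, so closed
      -- in `ω`), hence `y` is direct too
      have hyF : y ∈ flipSetW ends r s d ω := mem_flipSetW_of_edge hxF hyM hends
      refine ⟨hyF, ?_⟩
      have hω : ω e = false := by
        have := psiTwo_inside hxF hends hyM
        rw [this] at he
        cases hc : ω e
        · rfl
        · rw [hc] at he; exact (Bool.false_ne_true he).elim
      exact directW_of_edge hxD hyM hends hω
  · exfalso
    rcases hx with hx | hx | hx | hxK | ⟨hxF, _⟩
    · exact no_edge_out_term h hyO (Or.inl hx) hends
    · exact no_edge_out_term h hyO (Or.inr hx) hends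
    · exact no_edge_d_out h hyO (hx ▸ hends)
    · rw [psiTwo_Kcore h hxK hends, edge_Kcore_out hxK hyO hends] at he
      exact Bool.false_ne_true he
    · rw [psiTwo_flip_out_eq_false h hxF hyO hends] at he
      exact Bool.false_ne_true he

/-- **A non-direct flipped vertex is not in `K₂(Ψ₂ ω)`.** -/
theorem not_mem_K2_psiTwo_of_not_directW {x : V} (hx : x ∈ flipSetW ends r s d ω)
    (hd : ¬ directW ends r s d ω x) : x ∉ K2 ends r s (psiTwo ends r s d ω) := by
  intro hxK
  have key : x ∈ {z | z = r ∨ z = s ∨ z = d ∨ z ∈ Kcore ends r s d ω ∨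
      (z ∈ flipSetW ends r s d ω ∧ directW ends r s d ω z)} := by
    rcases mem_K2_iff.1 hxK with hc | hc
    · exact mem_of_conn_of_closed (Zdirect_closed h) (Or.inl rfl) hc
    · exact mem_of_conn_of_closed (Zdirect_closed h) (Or.inr (Or.inl rfl)) hc
  have hxM := flipSetW_subset_Mcore hx
  rcases key with hk | hk | hk | hk | ⟨_, hk⟩
  · exact term_not_mem_Mcore (Or.inl rfl) (hk ▸ hxM)
  · exact term_not_mem_Mcore (Or.inr rfl) (hk ▸ hxM)
  · exact d_not_mem_Mcore (hk ▸ hxM)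
  · exact not_mem_Mcore_of_mem_Kcore h.done hk hxM
  · exact hd hk

/-- **The non-direct flipped vertices are closed under the open edges of `Ψ₂ ω − d`.** -/
lemma nondirect_closed :
    ∀ x ∈ {z | z ∈ flipSetW ends r s d ω ∧ ¬ directW ends r s d ω z}, ∀ y,
      (openGraph (endsD ends d) (psiTwo ends r s d ω)).Adj x y →
        y ∈ {z | z ∈ flipSetW ends r s d ω ∧ ¬ directW ends r s d ω z} := by
  intro x hx y hxy
  obtain ⟨hne, hxd, hyd, e, he, hends⟩ := openGraph_endsD_adj.1 hxy
  obtain ⟨hxF, hxD⟩ := hx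
  have hxM := flipSetW_subset_Mcore hxF
  rcases vertex_cases (ends := ends) (r := r) (s := s) (d := d) (ω := ω) y with
    hy | hy | hy | hyK | hyM | hyO
  · exfalso
    exact hxD (directW_of_term_edge (Or.inl hy) hxM (ends_swap hends)
      (edge_Mcore_term h hxM (Or.inl hy) hends))
  · exfalso
    exact hxD (directW_of_term_edge (Or.inr hy) hxM (ends_swap hends)
      (edge_Mcore_term h hxM (Or.inr hy) hends))
  · exact (hyd hy).elim
  · exact (no_edge_core_core h hyK hxM (ends_swap hends)).elim
  · have hyF : y ∈ flipSetW ends r s d ω := mem_flipSetW_of_edge hxF hyM hends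
    refine ⟨hyF, fun hyD => hxD ?_⟩
    have hω : ω e = false := by
      have := psiTwo_inside hxF hends hyM
      rw [this] at he
      cases hc : ω e
      · rfl
      · rw [hc] at he; exact (Bool.false_ne_true he).elim
    exact directW_of_edge hyD hxM (ends_swap hends) hω
  · exfalso
    rw [psiTwo_flip_out_eq_false h hxF hyO hends] at he
    exact Bool.false_ne_true he

/-- **`Uset (Ψ₂ ω)` consists of non-direct flipped vertices** (no edge `r–s`). -/
theorem Uset_psiTwo_subset (hrs : ∀ e, ends e ≠ s(r, s)) :
    Uset ends r s d (psiTwo ends r s d ω) ⊆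
      {z | z ∈ flipSetW ends r s d ω ∧ ¬ directW ends r s d ω z} := by
  rintro z ⟨x, e, hends, he, hxK, hc⟩
  -- `x` is a `W`-core neighbour of `d` (no edge from `d` to the outside or to a terminal; an
  -- edge from `d` into the `Y`-core is open in `Ψ₂ ω`)
  have hxM : x ∈ Mcore ends r s d ω := by
    rcases vertex_cases (ends := ends) (r := r) (s := s) (d := d) (ω := ω) x with
      hx | hx | hx | hxK' | hxM | hxO
    · exact (no_edge_d_term h (Or.inl hx) hends).elim
    · exact (no_edge_d_term h (Or.inr hx) hends).elim
    · exact (hxK (by rw [hx]; exact mem_K2_psiTwo h)).elim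
    · exfalso
      rw [psiTwo_d_Kcore h hxK' hends, edge_Kcore_d h hxK' (ends_swap hends)] at he
      exact Bool.false_ne_true he.symm
    · exact hxM
    · exact (no_edge_d_out h hxO hends).elim
  have hxF : x ∈ flipSetW ends r s d ω := mem_flipSetW_of_nbr hxM hends
  have hxD : ¬ directW ends r s d ω x := fun hD => hxK (mem_K2_psiTwo_of_directW h hrs hxF hD)
  exact mem_of_conn_of_closed (nondirect_closed h) ⟨hxF, hxD⟩ hc

/-- **The reached set of `ω`'s `W`-world** : `{r, s, d} ∪ (direct `W`-core) ∪ (non-direct flipped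
vertices in `Uset (Ψ₂ ω)`)` is closed under the closed edges of `ω`. -/
lemma Pset_closed :
    ∀ x ∈ {z | z = r ∨ z = s ∨ z = d ∨ (z ∈ Mcore ends r s d ω ∧ directW ends r s d ω z) ∨
      (z ∈ flipSetW ends r s d ω ∧ ¬ directW ends r s d ω z ∧
        z ∈ Uset ends r s d (psiTwo ends r s d ω))}, ∀ y,
      (openGraph ends (OneColourSwitch.compl ω)).Adj x y →
        y ∈ {z | z = r ∨ z = s ∨ z = d ∨ (z ∈ Mcore ends r s d ω ∧ directW ends r s d ω z) ∨
          (z ∈ flipSetW ends r s d ω ∧ ¬ directW ends r s d ω z ∧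
            z ∈ Uset ends r s d (psiTwo ends r s d ω))} := by
  intro x hx y hxy
  obtain ⟨hne, e, he, hends⟩ := openGraph_adj.1 hxy
  have hω : ω e = false := by simpa [OneColourSwitch.compl] using he
  rcases vertex_cases (ends := ends) (r := r) (s := s) (d := d) (ω := ω) y with
    hy | hy | hy | hyK | hyM | hyO
  · exact Or.inl hy
  · exact Or.inr (Or.inl hy)
  · exact Or.inr (Or.inr (Or.inl hy))
  · exfalso
    rcases hx with hx | hx | hx | ⟨hxM, _⟩ | ⟨hxF, _, _⟩
    · rw [edge_Kcore_term h hyK (Or.inl hx) (ends_swap hends)] at hω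
      exact Bool.false_ne_true hω.symm
    · rw [edge_Kcore_term h hyK (Or.inr hx) (ends_swap hends)] at hω
      exact Bool.false_ne_true hω.symm
    · rw [edge_Kcore_d h hyK (ends_swap (hx ▸ hends))] at hω
      exact Bool.false_ne_true hω.symm
    · exact no_edge_core_core h hyK hxM (ends_swap hends)
    · exact no_edge_core_core h hyK (flipSetW_subset_Mcore hxF) (ends_swap hends)
  · -- `y` in the `W`-core
    rcases hx with hx | hx | hx | ⟨hxM, hxD⟩ | ⟨hxF, hxD, hxU⟩
    · exact Or.inr (Or.inr (Or.inr (Or.inl ⟨hyM, directW_of_term_edge (Or.inl hx) hyM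
        (hx ▸ hends) hω⟩)))
    · exact Or.inr (Or.inr (Or.inr (Or.inl ⟨hyM, directW_of_term_edge (Or.inr hx) hyM
        (hx ▸ hends) hω⟩)))
    · -- from `d`: `y` is a joined `W`-vertex; direct, or a `W`-neighbour of `d` outside
      -- `K₂(Ψ₂ ω)` with its `d`-edge kept closed
      have hyF : y ∈ flipSetW ends r s d ω := mem_flipSetW_of_nbr hyM (hx ▸ hends)
      by_cases hyD : directW ends r s d ω y
      · exact Or.inr (Or.inr (Or.inr (Or.inl ⟨hyM, hyD⟩)))
      · refine Or.inr (Or.inr (Or.inr (Or.inr ⟨hyF, hyD, y, e, hx ▸ hends, ?_,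
          not_mem_K2_psiTwo_of_not_directW h hyF hyD, conn_refl _ _ _⟩)))
        rw [psiTwo_d_joinedW_kept (hx ▸ hends) (fun hr' => hyD ?_), hω]
        unfold oppRoot at hr'
        split_ifs at hr' with hdr
        · exact Or.inr hr'
        · exact Or.inl hr'
    · exact Or.inr (Or.inr (Or.inr (Or.inl ⟨hyM, directW_of_edge hxD hyM hends hω⟩)))
    · -- from a non-direct flipped vertex: `y` is flipped, non-direct, and `Y`-adjacent to `x`
      -- in `Ψ₂ ω − d`
      have hyF : y ∈ flipSetW ends r s d ω := mem_flipSetW_of_edge hxF hyM hends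
      have hyD : ¬ directW ends r s d ω y := fun hyD =>
        hxD (directW_of_edge hyD (flipSetW_subset_Mcore hxF) (ends_swap hends) hω)
      refine Or.inr (Or.inr (Or.inr (Or.inr ⟨hyF, hyD, ?_⟩)))
      obtain ⟨x₀, e₀, hends₀, he₀, hx₀, hc₀⟩ := hxU
      refine ⟨x₀, e₀, hends₀, he₀, hx₀, conn_trans hc₀ (conn_of_openAdj ⟨e, ?_, ?_⟩)⟩
      · rw [psiTwo_inside hxF hends hyM, hω]; rfl
      · rw [endsD_of_notMem (notMem_of_ends_ne hends (flipSetW_subset_Mcore hxF).2.2.2 hyM.2.2.2)]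
        exact hends
  · exfalso
    rcases hx with hx | hx | hx | ⟨hxM, _⟩ | ⟨hxF, _, _⟩
    · exact no_edge_out_term h hyO (Or.inl hx) hends
    · exact no_edge_out_term h hyO (Or.inr hx) hends
    · exact no_edge_d_out h hyO (hx ▸ hends)
    · rw [edge_Mcore_out hxM hyO hends] at hω; exact Bool.false_ne_true hω.symm
    · rw [edge_Mcore_out (flipSetW_subset_Mcore hxF) hyO hends] at hω
      exact Bool.false_ne_true hω.symm

/-- **Every non-direct flipped vertex is in `Uset (Ψ₂ ω)`.** -/
theorem mem_Uset_psiTwo_of_not_directW {z : V} (hz : z ∈ flipSetW ends r s d ω)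
    (hzD : ¬ directW ends r s d ω z) : z ∈ Uset ends r s d (psiTwo ends r s d ω) := by
  have hzM := flipSetW_subset_Mcore hz
  have key : z ∈ {v | v = r ∨ v = s ∨ v = d ∨ (v ∈ Mcore ends r s d ω ∧ directW ends r s d ω v) ∨
      (v ∈ flipSetW ends r s d ω ∧ ¬ directW ends r s d ω v ∧
        v ∈ Uset ends r s d (psiTwo ends r s d ω))} := by
    rcases mem_M2_iff.1 hzM.1 with hc | hc
    · exact mem_of_conn_of_closed (Pset_closed h) (Or.inl rfl) hc
    · exact mem_of_conn_of_closed (Pset_closed h) (Or.inr (Or.inl rfl)) hc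
  rcases key with hk | hk | hk | ⟨_, hk⟩ | ⟨_, _, hk⟩
  · exact (term_not_mem_Mcore (Or.inl rfl) (hk ▸ hzM)).elim
  · exact (term_not_mem_Mcore (Or.inr rfl) (hk ▸ hzM)).elim
  · exact (d_not_mem_Mcore (hk ▸ hzM)).elim
  · exact (hzD hk).elim
  · exact hk

/-- **`Uset (Ψ₂ ω)` = the non-direct flipped vertices** (no edge `r–s`). -/
theorem Uset_psiTwo_eq (hrs : ∀ e, ends e ≠ s(r, s)) :
    Uset ends r s d (psiTwo ends r s d ω) =
      {z | z ∈ flipSetW ends r s d ω ∧ ¬ directW ends r s d ω z} :=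
  Set.Subset.antisymm (Uset_psiTwo_subset h hrs)
    (fun _ hz => mem_Uset_psiTwo_of_not_directW h hz.1 hz.2)

end Unrooted

end NoPocket

end Summit.Ventures.PercRepro2
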